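import Summits.Schanuel.Schanuel.Theorems.RootDecomp1KSectorSubspace04
import Summits.Schanuel.Schanuel.Theorems.RootDecomp1KSiegelBridge02

/-!
# RootDecomp1KGenusZeroNormShape — census-1 (gen 27) INSTRUMENT CERTIFICATE: the two GENUS-0 «FEW POLES» rows of
the LIVENESS table are DECIDED HYPOTHESIS-FREE by the TREE's conjugate-poles shape (B2b)

The census LIVENESS table (v49–v51, key `decided2_of_record`) carries UNDECIDED ×4 = {W4, DJ 2, specimen, M30}; the
instrument key `poles` (v51) splits them 2 + 2: W4 / DJ 2 have 4 geometric poles of `x` (genus 2 / 3), the specimen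
`Y⁴ + Y³ + x·Y − 17x²` (row 73, census NOTE 48 for CLAIM L3110) and `M30` (row 74, node 30, `RootDecomp1KSectorSubspace04`
§8) have 2 conjugate poles of `x` and GENUS 0 (singular members of the (4,2) sector box: `Δ_x` inseparable).  Both
genus-0 rows are RATIONAL curves over `ℚ` (a smooth rational point each), and an explicit `ℚ`-parametrisation of the
`x`-coordinate puts each of them VERBATIM in the TWO-CONJUGATE-POLES shape (B2b) of the tree's `SiegelClause`
(`RootDecomp1KLevelFinite11`), whose level finiteness `normShapeLevels_finite` is PROVED in the tree hypothesis-free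
(`RootDecomp1KLevelFinite09`, from the tree's `2`-adic Ridout step):

* specimen: `x = −s(s − 17)² / (17·(s² − 17)²)` with `s = −17x/r²` (`r ≠ 0`; `r = 0` forces `x = 0`), i.e.
  `g₀(s) = x·q(s)²` with `g₀ = −(1/17)·s(s − 17)²`, `q = s² − 17` (irreducible; `2` SPLIT, real: the grade
  `NormShapeLFSplitReal`, g47's residual family `q = t² − 17` — proved in the tree);
* `M30`: `x = (3t⁴ + 4t³ + 94t² − 148t + 159) / (4·(t² + 7)²)` with `t·(3 − 2r)(r − 1) = 22x + 4r² + r − 27`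
  (`r ≠ 1, 3/2`; `r = 1` forces `x = 1`, `r = 3/2` forces `x = 3/4`), i.e. `g₀(t) = x·q(t)²` with
  `g₀ = (1/4)(3t⁴ + 4t³ + 94t² − 148t + 159)`, `q = t² + 7` (irreducible; `2` SPLIT, imaginary: the grade
  `NormShapeLFSplitImag` — proved in the tree).

Hence, via the census bridge lemma `RootDecomp1KSiegelBridge.normShape_of_param` (integer scaling) and the tree's
`levelFinite_of_siegelClause` / `thinFibreAt_of_levelFinite`: `SiegelClause`, `LevelFinite`, `BddLevelEmpty` and
`ThinFibreAt m₀` for EVERY `m₀`, for both rows, WITHOUT `PadicSubspace` (node 30's conditional decisions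
`thinFibreAt_m30_of_padicSubspace` / `…box_of_padicSubspace` are superseded on these two members).  The UNDECIDED list of
record thereby reads ×2 = {W4, DJ 2} (both with ≥ 3 poles of `x`: the Siegel / Corvaja–Zannier binder class).
Census instrument, ×0 unless the critic rules otherwise; rung 0; nothing here proves Schanuel, 33364, 33363, 31077,
31987, `ThinFibre 2`, W4, DJ 2 or a binder.  No `private`, no `instance`, no `set_option`, no notation, no sorry, no axiom.
-/

noncomputable section

namespace Summit.Schanuel.Schanuel.Theorems.RootDecomp1KGenusZeroNormShape

open Polynomial
open Summit.Schanuel.Schanuel.Theorems.RootDecomp1KDegreeLadder (bev ThinFibreAt)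
open Summit.Schanuel.Schanuel.Theorems.RootDecomp1KLevelFinite (LevelFinite SiegelClause levelFinite_of_siegelClause
  thinFibreAt_of_levelFinite)
open Summit.Schanuel.Schanuel.Theorems.RootDecomp1KHeightGrading (BddLevelEmpty bddLevelEmpty_iff_levelFinite)
open Summit.Schanuel.Schanuel.Theorems.RootDecomp1KSectorSubspace (SectorBox boxP bev_boxP m30Box bev_m30)
open Summit.Schanuel.Schanuel.Theorems.RootDecomp1KSiegelBridge (normShape_of_param)

/-! ## §0  Two irreducible quadratics over `ℚ` -/

/-- `t² − 17` is irreducible over `ℚ` (`√17` is irrational). -/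
theorem irreducible_X_sq_sub_seventeen : Irreducible (X ^ 2 - C 17 : ℚ[X]) := by
  refine irreducible_of_degree_le_three_of_not_isRoot ?_ fun s hs => ?_
  · have : (X ^ 2 - C 17 : ℚ[X]).natDegree = 2 := by compute_degree!
    rw [this]; decide
  · have h : s ^ 2 = 17 := by
      have := hs; simp only [IsRoot.def, eval_sub, eval_pow, eval_X, eval_C] at this; linarith
    have hirr : Irrational (Real.sqrt 17) := Nat.Prime.irrational_sqrt (by norm_num)
    refine hirr ⟨|s|, ?_⟩
    have h' : ((|s| : ℚ) : ℝ) ^ 2 = 17 := by push_cast; rw [sq_abs]; exact_mod_cast h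
    have hnn : (0 : ℝ) ≤ ((|s| : ℚ) : ℝ) := by exact_mod_cast abs_nonneg s
    rw [← h', Real.sqrt_sq hnn]

/-- `t² + 7` is irreducible over `ℚ` (no real root). -/
theorem irreducible_X_sq_add_seven : Irreducible (X ^ 2 + 7 : ℚ[X]) := by
  refine irreducible_of_degree_le_three_of_not_isRoot ?_ fun s hs => ?_
  · have : (X ^ 2 + 7 : ℚ[X]).natDegree = 2 := by compute_degree!
    rw [this]; decide
  · have h : s ^ 2 + 7 = 0 := by
      have := hs; simp only [IsRoot.def, eval_add, eval_pow, eval_X, eval_ofNat] at this; linarith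
    nlinarith [sq_nonneg s]

/-! ## §1  The specimen `Y⁴ + Y³ + x·Y − 17x²` (LIVENESS row 73) -/

/-- `P_spec(x, y) = y⁴ + y³ + x·y − 17x²` — the specimen is the member `boxP ⟨1, 0, 0, 0, 0, 1, 0, -17⟩` of node 30's
(4,2) sector box (`δ = 1`, `ζ₂ = ζ₁ = ζ₀ = 0`, `α = 0`, `β = 1`, `ε = 0`, `γ = −17`; written inline throughout, no new
definition). -/
theorem bev_specimen (x y : ℝ) :
    bev (boxP ⟨1, 0, 0, 0, 0, 1, 0, -17⟩) x y = y ^ 4 + y ^ 3 + x * y - 17 * x ^ 2 := by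
  rw [bev_boxP]
  simp
  ring

/-- THE NORM-SHAPE PARAMETRISATION of the specimen: a rational point `(x, r)` with `r ≠ 0` has
`x·(s² − 17)² = −s(s − 17)²/17` for `s = −17x/r²` (then `r = (17 − s)/(s² − 17)`, `x = −s·r²/17`). -/
theorem specimen_normShape (x r : ℚ) (h : r ^ 4 + r ^ 3 + x * r - 17 * x ^ 2 = 0) (hr : r ≠ 0) :
    ∃ s : ℚ, (C (-1 / 17 : ℚ) * (X * (X - C 17) ^ 2)).eval s = x * ((X ^ 2 - C 17 : ℚ[X]).eval s) ^ 2 := by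
  obtain ⟨s, hs⟩ : ∃ s : ℚ, s * r ^ 2 = -17 * x := ⟨-17 * x / r ^ 2, by field_simp⟩
  have hx : x = -(s * r ^ 2) / 17 := by linear_combination (1 / 17 : ℚ) * hs
  have key : r ^ 3 * (r * (s ^ 2 - 17) - (17 - s)) = 0 := by
    rw [hx] at h
    linear_combination (-17 : ℚ) * h
  have hsr : r * (s ^ 2 - 17) = 17 - s := by
    rcases mul_eq_zero.mp key with h3 | h3
    · exact absurd (pow_eq_zero_iff three_ne_zero |>.mp h3) hr
    · linear_combination h3
  have h17 : s ^ 2 - 17 ≠ 0 := by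
    intro h0
    have hs17 : s = 17 := by
      have : (17 : ℚ) - s = 0 := by rw [← hsr, h0, mul_zero]
      linarith
    rw [hs17] at h0
    norm_num at h0
  have hr' : r = (17 - s) / (s ^ 2 - 17) := by
    field_simp
    linear_combination hsr
  refine ⟨s, ?_⟩
  simp only [eval_mul, eval_C, eval_pow, eval_sub, eval_X]
  rw [hx, hr']
  field_simp
  ring

/-- **the specimen satisfies SIEGEL's CLAUSE, hypothesis-free** — disjunct (B2b), two conjugate poles over `ℚ(√17)`,
exceptional set `E = {0}` (the fibre `r = 0` is `x = 0`). -/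
theorem siegelClause_specimen : SiegelClause (boxP ⟨1, 0, 0, 0, 0, 1, 0, -17⟩) := by
  refine Or.inr (Or.inr (Or.inr ?_))
  refine normShape_of_param (boxP ⟨1, 0, 0, 0, 0, 1, 0, -17⟩) {0} (g₀ := C (-1 / 17 : ℚ) * (X * (X - C 17) ^ 2))
    (q := X ^ 2 - C 17) (a := 2) irreducible_X_sq_sub_seventeen (by compute_degree!) ?_ (by norm_num) ?_ ?_
  · -- `q ∤ g₀`: `q` is prime and every factor of `g₀` has degree `≤ 1`
    intro hd
    have hp : Prime (X ^ 2 - C 17 : ℚ[X]) := irreducible_X_sq_sub_seventeen.prime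
    have hq2 : (X ^ 2 - C 17 : ℚ[X]).natDegree = 2 := by compute_degree!
    have hC : (C (-1 / 17 : ℚ)) ≠ 0 := C_ne_zero.mpr (by norm_num)
    have hX17 : (X - C 17 : ℚ[X]) ≠ 0 := X_sub_C_ne_zero 17
    rcases hp.dvd_or_dvd hd with h1 | h1
    · have := natDegree_le_of_dvd h1 hC
      rw [hq2, natDegree_C] at this
      omega
    · rcases hp.dvd_or_dvd h1 with h2 | h2
      · have := natDegree_le_of_dvd h2 X_ne_zero
        rw [hq2, natDegree_X] at this
        omega
      · have := natDegree_le_of_dvd (hp.dvd_of_dvd_pow h2) hX17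
        rw [hq2, natDegree_X_sub_C] at this
        omega
  · have : (C (-1 / 17 : ℚ) * (X * (X - C 17) ^ 2)).natDegree ≤ 3 := by compute_degree
    omega
  · intro x r hxr
    have h : r ^ 4 + r ^ 3 + x * r - 17 * x ^ 2 = 0 := by
      have h' : (((r ^ 4 + r ^ 3 + x * r - 17 * x ^ 2 : ℚ)) : ℝ) = 0 := by
        rw [bev_specimen] at hxr
        push_cast
        linear_combination hxr
      exact_mod_cast h'
    by_cases hr : r = 0
    · left
      rw [hr] at h
      have hx : x = 0 := by
        have : x ^ 2 = 0 := by linear_combination (-1 / 17 : ℚ) * h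
        exact pow_eq_zero_iff two_ne_zero |>.mp this
      simp [hx]
    · exact Or.inr (specimen_normShape x r h hr)

/-- **LEVEL FINITENESS of the specimen, hypothesis-free** (tree `levelFinite_of_siegelClause`: the (B2b) levels are
finite by `normShapeLevels_finite`). -/
theorem levelFinite_specimen : LevelFinite (boxP ⟨1, 0, 0, 0, 0, 1, 0, -17⟩) :=
  levelFinite_of_siegelClause siegelClause_specimen

/-- `BddLevelEmpty` for the specimen, hypothesis-free. -/
theorem bddLevelEmpty_specimen : BddLevelEmpty (boxP ⟨1, 0, 0, 0, 0, 1, 0, -17⟩) :=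
  (bddLevelEmpty_iff_levelFinite _).mpr levelFinite_specimen

/-- **THE THIN-FIBRE CLAUSE for the specimen at EVERY quality `m₀`, hypothesis-free** — LIVENESS row 73 DECIDED. -/
theorem thinFibreAt_specimen (m₀ : ℕ) : ThinFibreAt m₀ (boxP ⟨1, 0, 0, 0, 0, 1, 0, -17⟩) :=
  thinFibreAt_of_levelFinite levelFinite_specimen m₀

/-! ## §2  `M30 = (Y⁴ − Y³ − 6Y² + 2Y + 15) + x·(4Y² + Y − 27) + 11x²` (LIVENESS row 74, node 30 §8) -/

/-- THE NORM-SHAPE PARAMETRISATION of `M30`: a rational point `(x, r)` with `r ≠ 1`, `r ≠ 3/2` has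
`x·(t² + 7)² = (3t⁴ + 4t³ + 94t² − 148t + 159)/4` for the `t` with `t·(3 − 2r)(r − 1) = 22x + 4r² + r − 27`
(then `r = (3t² − 23)/(2t² + 14)`; the conic of the normalisation is `z² = (3 − 2r)(14r + 23)`, `z = t(3 − 2r)`). -/
theorem m30_normShape (x r : ℚ)
    (h : 11 * x ^ 2 + (4 * r ^ 2 + r - 27) * x + (r ^ 4 - r ^ 3 - 6 * r ^ 2 + 2 * r + 15) = 0)
    (hr1 : r ≠ 1) (hr2 : r ≠ 3 / 2) :
    ∃ t : ℚ, (C (1 / 4 : ℚ) * (3 * X ^ 4 + 4 * X ^ 3 + 94 * X ^ 2 - 148 * X + 159)).eval t =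
      x * ((X ^ 2 + 7 : ℚ[X]).eval t) ^ 2 := by
  have hw1 : r - 1 ≠ 0 := sub_ne_zero.mpr hr1
  have hw2 : 3 - 2 * r ≠ 0 := by
    intro h0; apply hr2; linarith
  obtain ⟨t, ht⟩ : ∃ t : ℚ, t * ((3 - 2 * r) * (r - 1)) = 22 * x + 4 * r ^ 2 + r - 27 :=
    ⟨(22 * x + 4 * r ^ 2 + r - 27) / ((3 - 2 * r) * (r - 1)), div_mul_cancel₀ _ (mul_ne_zero hw2 hw1)⟩
  have hx : x = (t * ((3 - 2 * r) * (r - 1)) - (4 * r ^ 2 + r - 27)) / 22 := by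
    linear_combination (-1 / 22 : ℚ) * ht
  have key : (r - 1) ^ 2 * (3 - 2 * r) * (t ^ 2 * (3 - 2 * r) - (14 * r + 23)) = 0 := by
    rw [hx] at h
    linear_combination (44 : ℚ) * h
  have htt : t ^ 2 * (3 - 2 * r) = 14 * r + 23 := by
    have hne : (r - 1) ^ 2 * (3 - 2 * r) ≠ 0 := mul_ne_zero (pow_ne_zero 2 hw1) hw2
    rcases mul_eq_zero.mp key with h3 | h3
    · exact absurd h3 hne
    · linear_combination h3
  have h7 : 2 * t ^ 2 + 14 ≠ 0 := by positivity
  have hr' : r = (3 * t ^ 2 - 23) / (2 * t ^ 2 + 14) := by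
    field_simp
    linear_combination (-1 : ℚ) * htt
  refine ⟨t, ?_⟩
  simp only [eval_mul, eval_C, eval_pow, eval_add, eval_sub, eval_X, eval_ofNat]
  rw [hx, hr']
  field_simp
  ring

/-- **`M30` satisfies SIEGEL's CLAUSE, hypothesis-free** — disjunct (B2b), two conjugate poles over `ℚ(√−7)`,
exceptional set `E = {1, 3/4}` (the fibre `r = 1` is the singular point `x = 1`, the fibre `r = 3/2` is the branch
point `x = 3/4`). -/
theorem siegelClause_m30 : SiegelClause (boxP m30Box) := by
  refine Or.inr (Or.inr (Or.inr ?_))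
  refine normShape_of_param (boxP m30Box) {1, 3 / 4}
    (g₀ := C (1 / 4 : ℚ) * (3 * X ^ 4 + 4 * X ^ 3 + 94 * X ^ 2 - 148 * X + 159))
    (q := X ^ 2 + 7) (a := 2) irreducible_X_sq_add_seven (by compute_degree!) ?_ (by norm_num) ?_ ?_
  · -- `q ∤ g₀`: the remainder of `4g₀` modulo `q` is `−176(t + 2) ≠ 0`
    intro hd
    have hq2 : (X ^ 2 + 7 : ℚ[X]).natDegree = 2 := by compute_degree!
    have hG : (X ^ 2 + 7 : ℚ[X]) ∣ (3 * X ^ 4 + 4 * X ^ 3 + 94 * X ^ 2 - 148 * X + 159) := by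
      have h4 := hd.mul_left (C (4 : ℚ))
      rwa [← mul_assoc, ← C_mul, show (4 : ℚ) * (1 / 4) = 1 by norm_num, C_1, one_mul] at h4
    have hrem : (X ^ 2 + 7 : ℚ[X]) ∣ (-176 * X - 352 : ℚ[X]) := by
      have e : (-176 * X - 352 : ℚ[X]) =
          (3 * X ^ 4 + 4 * X ^ 3 + 94 * X ^ 2 - 148 * X + 159) - (X ^ 2 + 7) * (3 * X ^ 2 + 4 * X + 73) := by
        ring
      rw [e]
      exact dvd_sub hG (dvd_mul_right _ _)
    have hdeg : (-176 * X - 352 : ℚ[X]).natDegree = 1 := by compute_degree!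
    have hne : (-176 * X - 352 : ℚ[X]) ≠ 0 := ne_zero_of_natDegree_gt (n := 0) (by rw [hdeg]; norm_num)
    have := natDegree_le_of_dvd hrem hne
    rw [hq2, hdeg] at this
    omega
  · have : (C (1 / 4 : ℚ) * (3 * X ^ 4 + 4 * X ^ 3 + 94 * X ^ 2 - 148 * X + 159 : ℚ[X])).natDegree ≤ 4 := by
      compute_degree
    omega
  · intro x r hxr
    have h : 11 * x ^ 2 + (4 * r ^ 2 + r - 27) * x + (r ^ 4 - r ^ 3 - 6 * r ^ 2 + 2 * r + 15) = 0 := by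
      have h' : (((11 * x ^ 2 + (4 * r ^ 2 + r - 27) * x + (r ^ 4 - r ^ 3 - 6 * r ^ 2 + 2 * r + 15) : ℚ)) : ℝ)
          = 0 := by
        rw [bev_m30] at hxr
        push_cast
        linear_combination hxr
      exact_mod_cast h'
    by_cases hr1 : r = 1
    · left
      rw [hr1] at h
      have hx : x = 1 := by
        have : (x - 1) ^ 2 = 0 := by linear_combination (1 / 11 : ℚ) * h
        exact sub_eq_zero.mp (pow_eq_zero_iff two_ne_zero |>.mp this)
      simp [hx]
    by_cases hr2 : r = 3 / 2
    · left
      rw [hr2] at h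
      have hx : x = 3 / 4 := by
        have : (x - 3 / 4) ^ 2 = 0 := by linear_combination (1 / 11 : ℚ) * h
        exact sub_eq_zero.mp (pow_eq_zero_iff two_ne_zero |>.mp this)
      simp [hx]
    · exact Or.inr (m30_normShape x r h hr1 hr2)

/-- **LEVEL FINITENESS of `M30`, hypothesis-free** (supersedes `levelFinite_m30_of_padicSubspace` on this member). -/
theorem levelFinite_m30 : LevelFinite (boxP m30Box) :=
  levelFinite_of_siegelClause siegelClause_m30

/-- `BddLevelEmpty` for `M30`, hypothesis-free. -/
theorem bddLevelEmpty_m30 : BddLevelEmpty (boxP m30Box) :=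
  (bddLevelEmpty_iff_levelFinite _).mpr levelFinite_m30

/-- **THE THIN-FIBRE CLAUSE for `M30` at EVERY quality `m₀`, hypothesis-free** (supersedes
`thinFibreAt_m30_of_padicSubspace`) — LIVENESS row 74 DECIDED. -/
theorem thinFibreAt_m30 (m₀ : ℕ) : ThinFibreAt m₀ (boxP m30Box) :=
  thinFibreAt_of_levelFinite levelFinite_m30 m₀

end Summit.Schanuel.Schanuel.Theorems.RootDecomp1KGenusZeroNormShape
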